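import Literature.NumberTheory.Automorphic.CuspidalCohomologyGLHecke
import Mathlib.RepresentationTheory.Homological.GroupCohomology.Shapiro
import Mathlib.Combinatorics.Quiver.ReflQuiver
import HarnessLib

/-!
# The cohomology of a boundary stratum is the cohomology of its parabolic (Shapiro)

Topic `NumberTheory/Automorphic`; namespace `Literature.NumberTheory.Automorphic.TwistedQuotient` (the
generic layer of `CuspidalCohomologyGL`: `ι : Γ →* 𝒢`, level `L ≤ 𝒢`, `ρ : Γ → GL(V)`, a poset `P`
of proper rational parabolics with a monotone `Γ`-action, boundary cochains
`bdryRep ι L ρ P hP 0 = Fun(N(P)₀ × 𝒢/L, V)`).  A *proofs* file (definitions with bodies and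
theorems; no named fact, no instance) supporting
`Literature.NumberTheory.Automorphic.bianchi_boundaryEigensystem_isReducible`: the second step of
its printed proof, the passage from the boundary of the Borel–Serre compactification to the
parabolic subgroups — for `GL₂`, where the building `ℙ¹(F)` is one `GL₂(F)`-orbit with stabiliser
the Borel `B(F)`, "`H^•(∂S_K, M̃) = H^•(B(ℚ)\G(𝔸)/K_∞K, M̃)`", the starting point of Harder's
computation of the cohomology of the boundary [Harder1987, §1], [Schwermer2010, §6 (6.1)–(6.2)].

Fix a vertex `x₀ ∈ P` with stabiliser `Γ_{x₀} = Stab_Γ(x₀)` (for `GL₂` and `x₀ = ∞ ∈ ℙ¹(F)`: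
`B(F)`).  The twisted coefficient module of the SUBGROUP `Γ_{x₀}` (same `𝒢`, `L`, `V`; `ι` and `ρ`
restricted) is `coeffRep (ι.comp Γ_{x₀}.subtype) L (ρ.comp Γ_{x₀}.subtype) = Fun(𝒢/L, V)`, whose
cohomology `cohomology (ι.comp Γ_{x₀}.subtype) L (ρ.comp Γ_{x₀}.subtype) q = H^q(Γ_{x₀}, Fun(𝒢/L, V))`
is the cohomology of the stratum `Γ_{x₀}\(e(x₀) × 𝒢/L)` and carries the Hecke operators
`heckeOperator (ι.comp Γ_{x₀}.subtype) L (ρ.comp Γ_{x₀}.subtype) g` of the SAME double cosets.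

## Main definitions and results

* `vertexStabilizer x₀`, `vertex x₀` (the `0`-simplex `{x₀}` of `N(P)`), `stratumRep` (the
  `Γ_{x₀}`-representation `Fun(𝒢/L, V)`).
* `bdryOrbitRestrict : Fun(N(P)₀ × 𝒢/L, V) ⟶ Coind_{Γ_{x₀}}^Γ Fun(𝒢/L, V)`,
  `F ↦ (γ ↦ (c ↦ ρ(γ) F({γ⁻¹x₀}, ι(γ)⁻¹c)))` (restriction to the orbit of `x₀`), and
  `bdryOrbitExtend` (extension by zero); `bdryOrbitExtend ≫ bdryOrbitRestrict = 𝟙` always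
  (`bdryOrbitExtend_comp_bdryOrbitRestrict`), and `bdryOrbitRestrict ≫ bdryOrbitExtend = 𝟙` when
  `Γ` is transitive on `P` (`bdryOrbitRestrict_comp_bdryOrbitExtend`), i.e.
  **`Fun(N(P)₀ × 𝒢/L, V) ≅ Coind_{Γ_{x₀}}^Γ Fun(𝒢/L, V)`** (`bdryOrbitIso`).
* Hecke: `bdryOrbitRestrict ≫ Coind(T_g) = T_g ≫ bdryOrbitRestrict`
  (`bdryOrbitRestrict_comp_coindMap_heckeRepHom`) — the double-coset operators act on the coset
  variable on both sides.
* Cohomology: `bdryOrbitRestrictMap`, `bdryOrbitExtendMap` (`H^q` of the two maps),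
  `toStratumCohomology q : H^q(Γ, Fun(N(P)₀ × 𝒢/L, V)) ⟶ H^q(Γ_{x₀}, Fun(𝒢/L, V))` (restriction to
  the orbit, then Mathlib's Shapiro isomorphism `groupCohomology.coindIso`) and `ofStratumCohomology`,
  with `of ≫ to = 𝟙` (`ofStratumCohomology_comp_toStratumCohomology`: the stratum of `x₀` is a
  direct summand) and, for a transitive action, `to ≫ of = 𝟙`, so that `toStratumCohomology` is an
  ISOMORPHISM (`isIso_toStratumCohomology`): **`H^q(∂S_L, Ṽ) ≅ H^q(Γ_{x₀}, Fun(𝒢/L, V))`** for a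
  discrete building with one cusp orbit; the Hecke operators `coindHeckeOperator` (`H^q(Coind T_g)`),
  `bdryColumnHeckeOperator` (`T_g` on column `0`, = `bdryHeckeOperator` of
  `BoundaryRestrictionHecke`) and the Hecke-equivariance of the first factor
  (`bdryOrbitRestrictMap_comp_coindHeckeOperator`).

Not here: the Hecke-equivariance of Mathlib's `coindIso` itself (naturality of Shapiro's
isomorphism in the coefficient module), hence of `toStratumCohomology`; the case of several
`Γ`-orbits on `P` (sum over cusps).

## References

* G. Harder, *Eisenstein cohomology of arithmetic groups. The case GL₂*, Invent. Math. 89 (1987), §1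
  [Harder1987].
* J. Schwermer, *Geometric cycles, arithmetic groups and their cohomology*, Bull. AMS 47 (2010), §6,
  (6.1)–(6.2) [Schwermer2010].
* K. S. Brown, *Cohomology of groups*, GTM 87 (1982), III §5–6 (Shapiro's lemma)
  [Brown1982CohomologyGroups].
-/

noncomputable section

open CategoryTheory
open scoped Classical

universe u

namespace Literature.NumberTheory.Automorphic

namespace TwistedQuotient

variable {k : Type u} [CommRing k] {Γ 𝒢 : Type u} [Group Γ] [Group 𝒢]
variable (ι : Γ →* 𝒢) (L : Subgroup 𝒢) {V : Type u} [AddCommGroup V] [Module k V]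
  (ρ : Representation k Γ V) (P : Type u) [Preorder P] [MulAction Γ P]
  (hP : ∀ γ : Γ, Monotone fun x : P => γ • x) (x₀ : P)

/-! ### The stabiliser of a vertex and the stratum representation `Fun(𝒢/L, V)` -/

variable {P} in
/-- The stabiliser `Γ_{x₀}` of the vertex `x₀ ∈ P` — for `GL₂`, `P = ℙ¹(F)` and `x₀ = ∞` this is
the Borel subgroup `B(F)`. [cite: Schwermer2010, §6 (6.1)] -/
abbrev vertexStabilizer : Subgroup Γ :=
  MulAction.stabilizer Γ x₀

variable {P} in
/-- The `0`-simplex `{x}` of the nerve `N(P)` (a chain of length one). [folklore] -/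
def vertex (x : P) : Fin (0 + 1) →o P :=
  ⟨fun _ => x, fun _ _ _ => le_rfl⟩

variable {P} in
/-- Unfolding lemma for `vertex`. [folklore] -/
@[simp]
theorem vertex_apply (x : P) (i : Fin (0 + 1)) : vertex x i = x :=
  rfl

variable {P} in
/-- Every `0`-simplex is the vertex of its value at `0`. [folklore] -/
theorem vertex_apply_zero_eq (σ : Fin (0 + 1) →o P) : vertex (σ 0) = σ :=
  OrderHom.ext _ _ (funext fun i => by rw [vertex_apply, Fin.eq_zero i])

variable {P} in
/-- The `Γ`-action on `0`-simplices moves the vertex: `γ • {x} = {γ • x}`. [folklore] -/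
theorem bdryAct_vertex (γ : Γ) (x : P) (c : 𝒢 ⧸ L) :
    bdryAct ι L hP 0 γ (vertex x, c) = (vertex (γ • x), ι γ • c) :=
  Prod.ext (OrderHom.ext _ _ (funext fun _ => rfl)) rfl

variable {P} in
/-- **The stratum representation**: `Fun(𝒢/L, V)` as a representation of the stabiliser `Γ_{x₀}`
(twisted coefficients for the subgroup, `ι` and `ρ` restricted) — the coefficient module of the
boundary stratum `Γ_{x₀}\(e(x₀) × 𝒢/L)`. [cite: Schwermer2010, §6 (6.2)] -/
abbrev stratumRep : Rep k (vertexStabilizer x₀ : Subgroup Γ) :=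
  coeffRep (ι.comp (vertexStabilizer (Γ := Γ) x₀).subtype) L
    (ρ.comp (vertexStabilizer (Γ := Γ) x₀).subtype)

/-! ### Restriction to the orbit of `x₀` -/

variable {P} in
/-- **Restriction to the orbit of `x₀`** (as a linear map)
`Fun(N(P)₀ × 𝒢/L, V) → Coind_{Γ_{x₀}}^Γ Fun(𝒢/L, V)`, `F ↦ (γ ↦ (c ↦ ρ(γ) F({γ⁻¹ x₀}, ι(γ)⁻¹ c)))`.
[cite: Brown1982CohomologyGroups, III §5] -/
def bdryOrbitRestrictLinear :
    (BdrySimplex L P 0 → V) →ₗ[k]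
      Representation.coindV (vertexStabilizer (Γ := Γ) x₀).subtype
        (coeffRepresentation (ι.comp (vertexStabilizer (Γ := Γ) x₀).subtype) L
          (ρ.comp (vertexStabilizer (Γ := Γ) x₀).subtype)) where
  toFun F := ⟨fun γ c => ρ γ (F (vertex (γ⁻¹ • x₀), (ι γ)⁻¹ • c)), fun s γ => by
    funext c
    have hs : (s : Γ)⁻¹ • x₀ = x₀ := by
      rw [inv_smul_eq_iff]
      exact (MulAction.mem_stabilizer_iff.mp s.2).symm
    change ρ ((s : Γ) * γ) (F (vertex (((s : Γ) * γ)⁻¹ • x₀), (ι ((s : Γ) * γ))⁻¹ • c)) =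
      ρ (s : Γ) (ρ γ (F (vertex (γ⁻¹ • x₀), (ι γ)⁻¹ • (ι (s : Γ))⁻¹ • c)))
    rw [map_mul, Module.End.mul_apply, mul_inv_rev, mul_smul, hs, map_mul, mul_inv_rev,
      mul_smul]⟩
  map_add' F F' := by
    refine Subtype.ext (funext fun γ => funext fun c => ?_)
    simp
  map_smul' a F := by
    refine Subtype.ext (funext fun γ => funext fun c => ?_)
    simp

variable {P} in
/-- Unfolding lemma for `bdryOrbitRestrictLinear`. [folklore] -/
@[simp]
theorem bdryOrbitRestrictLinear_apply_coe (F : BdrySimplex L P 0 → V) (γ : Γ) (c : 𝒢 ⧸ L) :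
    (bdryOrbitRestrictLinear ι L ρ x₀ F : Γ → (𝒢 ⧸ L) → V) γ c =
      ρ γ (F (vertex (γ⁻¹ • x₀), (ι γ)⁻¹ • c)) :=
  rfl

variable {P} in
/-- Restriction to the orbit is `Γ`-equivariant. [folklore] -/
theorem bdryOrbitRestrictLinear_bdryRepresentation (γ' : Γ) (F : BdrySimplex L P 0 → V) :
    bdryOrbitRestrictLinear ι L ρ x₀ (bdryRepresentation ι L ρ P hP 0 γ' F) =
      Representation.coind (vertexStabilizer (Γ := Γ) x₀).subtype
        (coeffRepresentation (ι.comp (vertexStabilizer (Γ := Γ) x₀).subtype) L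
          (ρ.comp (vertexStabilizer (Γ := Γ) x₀).subtype)) γ'
        (bdryOrbitRestrictLinear ι L ρ x₀ F) := by
  refine Subtype.ext (funext fun γ => funext fun c => ?_)
  change ρ γ (bdryRepresentation ι L ρ P hP 0 γ' F (vertex (γ⁻¹ • x₀), (ι γ)⁻¹ • c)) =
    ρ (γ * γ') (F (vertex ((γ * γ')⁻¹ • x₀), (ι (γ * γ'))⁻¹ • c))
  rw [bdryRepresentation_apply, bdryAct_vertex]
  simp only [map_mul, map_inv, mul_inv_rev, mul_smul, Module.End.mul_apply]

variable {P} in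
/-- **Restriction to the orbit of `x₀`** as a morphism of `Γ`-representations
`Fun(N(P)₀ × 𝒢/L, V) ⟶ Coind_{Γ_{x₀}}^Γ Fun(𝒢/L, V)`. [cite: Brown1982CohomologyGroups, III §5] -/
def bdryOrbitRestrict :
    bdryRep ι L ρ P hP 0 ⟶
      Rep.coind (vertexStabilizer (Γ := Γ) x₀).subtype (stratumRep ι L ρ x₀) :=
  Rep.ofHom (LinearMap.intertwiningMap_of_isIntertwiningMap (bdryRepresentation ι L ρ P hP 0)
    (Representation.coind (vertexStabilizer (Γ := Γ) x₀).subtype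
      (coeffRepresentation (ι.comp (vertexStabilizer (Γ := Γ) x₀).subtype) L
        (ρ.comp (vertexStabilizer (Γ := Γ) x₀).subtype)))
    (bdryOrbitRestrictLinear ι L ρ x₀) (bdryOrbitRestrictLinear_bdryRepresentation ι L ρ hP x₀))

variable {P} in
/-- Unfolding lemma for `bdryOrbitRestrict`. [folklore] -/
@[simp]
theorem bdryOrbitRestrict_hom_apply_coe (F : BdrySimplex L P 0 → V) (γ : Γ) (c : 𝒢 ⧸ L) :
    (((bdryOrbitRestrict ι L ρ hP x₀).hom F :
        Representation.coindV (vertexStabilizer (Γ := Γ) x₀).subtype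
          (coeffRepresentation (ι.comp (vertexStabilizer (Γ := Γ) x₀).subtype) L
            (ρ.comp (vertexStabilizer (Γ := Γ) x₀).subtype))) : Γ → (𝒢 ⧸ L) → V) γ c =
      ρ γ (F (vertex (γ⁻¹ • x₀), (ι γ)⁻¹ • c)) :=
  rfl

/-! ### Extension by zero from the orbit of `x₀` -/

variable {P} in
/-- **Extension by zero** (as a bare function): at a `0`-simplex with vertex `γ • x₀` and coset `c`
the value is `ρ(γ) (f(γ⁻¹)(ι(γ)⁻¹ c))` (independent of `γ`, `bdryOrbitExtendFun_eq`), and `0` at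
vertices off the orbit of `x₀`. [folklore] -/
def bdryOrbitExtendFun (f : Γ → (𝒢 ⧸ L) → V) (s : BdrySimplex L P 0) : V :=
  if h : ∃ γ : Γ, γ • x₀ = s.1 0 then
    ρ (Classical.choose h) (f (Classical.choose h)⁻¹ ((ι (Classical.choose h))⁻¹ • s.2))
  else 0

variable {P} in
/-- Off the orbit the extension vanishes. [folklore] -/
theorem bdryOrbitExtendFun_of_not (f : Γ → (𝒢 ⧸ L) → V) {s : BdrySimplex L P 0}
    (h : ¬ ∃ γ : Γ, γ • x₀ = s.1 0) : bdryOrbitExtendFun ι L ρ x₀ f s = 0 := by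
  rw [bdryOrbitExtendFun, dif_neg h]

variable {P} in
/-- **The extension is well defined**: on the orbit,
`E f ({γ x₀}, c) = ρ(γ) (f(γ⁻¹)(ι(γ)⁻¹ c))` for EVERY `γ` (by the defining property of the coinduced
module). [folklore] -/
theorem bdryOrbitExtendFun_eq
    (f : Representation.coindV (vertexStabilizer (Γ := Γ) x₀).subtype
      (coeffRepresentation (ι.comp (vertexStabilizer (Γ := Γ) x₀).subtype) L
        (ρ.comp (vertexStabilizer (Γ := Γ) x₀).subtype)))
    {s : BdrySimplex L P 0} {γ : Γ} (hγ : γ • x₀ = s.1 0) :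
    bdryOrbitExtendFun ι L ρ x₀ f s = ρ γ ((f : Γ → (𝒢 ⧸ L) → V) γ⁻¹ ((ι γ)⁻¹ • s.2)) := by
  have h : ∃ γ : Γ, γ • x₀ = s.1 0 := ⟨γ, hγ⟩
  rw [bdryOrbitExtendFun, dif_pos h]
  set γ' := Classical.choose h with hγ'def
  have hγ' : γ' • x₀ = s.1 0 := Classical.choose_spec h
  -- `t = γ⁻¹ γ' ∈ Γ_{x₀}` and `γ'⁻¹ = t⁻¹ γ⁻¹`
  have ht : γ⁻¹ * γ' ∈ vertexStabilizer (Γ := Γ) x₀ := by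
    rw [MulAction.mem_stabilizer_iff, mul_smul, hγ', ← hγ, inv_smul_smul]
  have hf := f.2 ⟨γ⁻¹ * γ', ht⟩ γ'⁻¹
  change (f : Γ → (𝒢 ⧸ L) → V) (γ⁻¹ * γ' * γ'⁻¹) =
    coeffRepresentation (ι.comp (vertexStabilizer (Γ := Γ) x₀).subtype) L
      (ρ.comp (vertexStabilizer (Γ := Γ) x₀).subtype) ⟨γ⁻¹ * γ', ht⟩
      ((f : Γ → (𝒢 ⧸ L) → V) γ'⁻¹) at hf
  rw [mul_inv_cancel_right] at hf
  have hf' := congr_fun hf ((ι γ)⁻¹ • s.2)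
  rw [coeffRepresentation_apply] at hf'
  change (f : Γ → (𝒢 ⧸ L) → V) γ⁻¹ ((ι γ)⁻¹ • s.2) =
    ρ (γ⁻¹ * γ') ((f : Γ → (𝒢 ⧸ L) → V) γ'⁻¹ ((ι (γ⁻¹ * γ'))⁻¹ • (ι γ)⁻¹ • s.2)) at hf'
  rw [hf', ← Module.End.mul_apply, ← map_mul, mul_inv_cancel_left, map_mul, map_inv, mul_inv_rev,
    inv_inv, mul_smul, smul_inv_smul]

variable {P} in
/-- Extension by zero, as a `k`-linear map `Coind_{Γ_{x₀}}^Γ Fun(𝒢/L, V) → Fun(N(P)₀ × 𝒢/L, V)`.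
[folklore] -/
def bdryOrbitExtendLinear :
    Representation.coindV (vertexStabilizer (Γ := Γ) x₀).subtype
        (coeffRepresentation (ι.comp (vertexStabilizer (Γ := Γ) x₀).subtype) L
          (ρ.comp (vertexStabilizer (Γ := Γ) x₀).subtype)) →ₗ[k]
      (BdrySimplex L P 0 → V) where
  toFun f := bdryOrbitExtendFun ι L ρ x₀ f
  map_add' f f' := by
    funext s
    by_cases h : ∃ γ : Γ, γ • x₀ = s.1 0
    · obtain ⟨γ, hγ⟩ := h
      rw [Pi.add_apply, bdryOrbitExtendFun_eq ι L ρ x₀ _ hγ, bdryOrbitExtendFun_eq ι L ρ x₀ _ hγ,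
        bdryOrbitExtendFun_eq ι L ρ x₀ _ hγ]
      change ρ γ ((f : Γ → (𝒢 ⧸ L) → V) γ⁻¹ ((ι γ)⁻¹ • s.2) +
        (f' : Γ → (𝒢 ⧸ L) → V) γ⁻¹ ((ι γ)⁻¹ • s.2)) = _
      rw [map_add]
    · rw [Pi.add_apply, bdryOrbitExtendFun_of_not ι L ρ x₀ _ h, bdryOrbitExtendFun_of_not ι L ρ x₀ _ h,
        bdryOrbitExtendFun_of_not ι L ρ x₀ _ h, add_zero]
  map_smul' a f := by
    funext s
    by_cases h : ∃ γ : Γ, γ • x₀ = s.1 0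
    · obtain ⟨γ, hγ⟩ := h
      rw [Pi.smul_apply, bdryOrbitExtendFun_eq ι L ρ x₀ _ hγ, bdryOrbitExtendFun_eq ι L ρ x₀ _ hγ,
        RingHom.id_apply]
      change ρ γ (a • (f : Γ → (𝒢 ⧸ L) → V) γ⁻¹ ((ι γ)⁻¹ • s.2)) = _
      rw [map_smul]
    · rw [Pi.smul_apply, bdryOrbitExtendFun_of_not ι L ρ x₀ _ h, bdryOrbitExtendFun_of_not ι L ρ x₀ _ h,
        smul_zero]

variable {P} in
/-- Unfolding lemma for `bdryOrbitExtendLinear`. [folklore] -/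
@[simp]
theorem bdryOrbitExtendLinear_apply
    (f : Representation.coindV (vertexStabilizer (Γ := Γ) x₀).subtype
      (coeffRepresentation (ι.comp (vertexStabilizer (Γ := Γ) x₀).subtype) L
        (ρ.comp (vertexStabilizer (Γ := Γ) x₀).subtype))) :
    bdryOrbitExtendLinear ι L ρ x₀ f = bdryOrbitExtendFun ι L ρ x₀ f :=
  rfl

/-- Extension by zero is `Γ`-equivariant (the orbit is `Γ`-stable). [folklore] -/
theorem bdryOrbitExtendLinear_coind (γ' : Γ)
    (f : Representation.coindV (vertexStabilizer (Γ := Γ) x₀).subtype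
      (coeffRepresentation (ι.comp (vertexStabilizer (Γ := Γ) x₀).subtype) L
        (ρ.comp (vertexStabilizer (Γ := Γ) x₀).subtype))) :
    bdryOrbitExtendLinear ι L ρ x₀ (Representation.coind (vertexStabilizer (Γ := Γ) x₀).subtype
        (coeffRepresentation (ι.comp (vertexStabilizer (Γ := Γ) x₀).subtype) L
          (ρ.comp (vertexStabilizer (Γ := Γ) x₀).subtype)) γ' f) =
      bdryRepresentation ι L ρ P hP 0 γ' (bdryOrbitExtendLinear ι L ρ x₀ f) := by
  funext s
  rw [bdryOrbitExtendLinear_apply, bdryOrbitExtendLinear_apply, bdryRepresentation_apply]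
  by_cases h : ∃ γ : Γ, γ • x₀ = s.1 0
  · obtain ⟨γ, hγ⟩ := h
    -- the translated simplex has vertex `γ'⁻¹ γ x₀`
    have h1 : (γ'⁻¹ * γ) • x₀ = (bdryAct ι L hP 0 γ'⁻¹ s).1 0 := by
      rw [bdryAct_fst_apply, mul_smul, hγ]
    rw [bdryOrbitExtendFun_eq ι L ρ x₀ _ hγ, bdryOrbitExtendFun_eq ι L ρ x₀ _ h1, bdryAct_snd,
      ← Module.End.mul_apply, ← map_mul, mul_inv_cancel_left, mul_inv_rev, inv_inv, map_mul,
      map_inv, mul_inv_rev, inv_inv, mul_smul, smul_inv_smul]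
    rfl
  · have h' : ¬ ∃ γ : Γ, γ • x₀ = (bdryAct ι L hP 0 γ'⁻¹ s).1 0 := by
      rintro ⟨γ, hγ⟩
      rw [bdryAct_fst_apply] at hγ
      exact h ⟨γ' * γ, by rw [mul_smul, hγ, smul_inv_smul]⟩
    rw [bdryOrbitExtendFun_of_not ι L ρ x₀ _ h, bdryOrbitExtendFun_of_not ι L ρ x₀ _ h', map_zero]

/-- **Extension by zero from the orbit of `x₀`** as a morphism of `Γ`-representations
`Coind_{Γ_{x₀}}^Γ Fun(𝒢/L, V) ⟶ Fun(N(P)₀ × 𝒢/L, V)`. [folklore] -/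
def bdryOrbitExtend :
    Rep.coind (vertexStabilizer (Γ := Γ) x₀).subtype (stratumRep ι L ρ x₀) ⟶ bdryRep ι L ρ P hP 0 :=
  Rep.ofHom (LinearMap.intertwiningMap_of_isIntertwiningMap
    (Representation.coind (vertexStabilizer (Γ := Γ) x₀).subtype
      (coeffRepresentation (ι.comp (vertexStabilizer (Γ := Γ) x₀).subtype) L
        (ρ.comp (vertexStabilizer (Γ := Γ) x₀).subtype)))
    (bdryRepresentation ι L ρ P hP 0) (bdryOrbitExtendLinear ι L ρ x₀)
    (bdryOrbitExtendLinear_coind ι L ρ P hP x₀))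

/-- Unfolding lemma for `bdryOrbitExtend`. [folklore] -/
@[simp]
theorem bdryOrbitExtend_hom_apply
    (f : Representation.coindV (vertexStabilizer (Γ := Γ) x₀).subtype
      (coeffRepresentation (ι.comp (vertexStabilizer (Γ := Γ) x₀).subtype) L
        (ρ.comp (vertexStabilizer (Γ := Γ) x₀).subtype))) :
    (bdryOrbitExtend ι L ρ P hP x₀).hom f = bdryOrbitExtendFun ι L ρ x₀ f :=
  rfl

/-- **Restriction after extension is the identity** on `Coind_{Γ_{x₀}}^Γ Fun(𝒢/L, V)`: the stratum of
`x₀` is a direct summand of the boundary. [cite: Brown1982CohomologyGroups, III §5] -/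
theorem bdryOrbitExtend_comp_bdryOrbitRestrict :
    bdryOrbitExtend ι L ρ P hP x₀ ≫ bdryOrbitRestrict ι L ρ hP x₀ = 𝟙 _ := by
  refine Rep.hom_ext (Representation.IntertwiningMap.ext (LinearMap.ext fun f => ?_))
  refine Subtype.ext (funext fun γ => funext fun c => ?_)
  change ρ γ (bdryOrbitExtendFun ι L ρ x₀ f (vertex (γ⁻¹ • x₀), (ι γ)⁻¹ • c)) =
    (f : Γ → (𝒢 ⧸ L) → V) γ c
  have h1 : γ⁻¹ • x₀ = (vertex (γ⁻¹ • x₀), (ι γ)⁻¹ • c).1 0 := rfl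
  rw [bdryOrbitExtendFun_eq ι L ρ x₀ f h1, inv_inv, ← Module.End.mul_apply, ← map_mul,
    mul_inv_cancel, map_one, Module.End.one_apply, map_inv, inv_inv, smul_inv_smul]

/-- **For a transitive action on `P`, restriction to the orbit is an isomorphism**: if `P = Γ x₀`
(one cusp orbit, as for `GL₂` on `ℙ¹(F)`), then `Fun(N(P)₀ × 𝒢/L, V) → Coind → Fun(N(P)₀ × 𝒢/L, V)`
is the identity too. [cite: Brown1982CohomologyGroups, III §5] -/
theorem bdryOrbitRestrict_comp_bdryOrbitExtend (htrans : ∀ x : P, ∃ γ : Γ, γ • x₀ = x) :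
    bdryOrbitRestrict ι L ρ hP x₀ ≫ bdryOrbitExtend ι L ρ P hP x₀ = 𝟙 _ := by
  refine Rep.hom_ext (Representation.IntertwiningMap.ext (LinearMap.ext fun F => ?_))
  funext s
  obtain ⟨γ, hγ⟩ := htrans (s.1 0)
  change bdryOrbitExtendFun ι L ρ x₀ (bdryOrbitRestrictLinear ι L ρ x₀ F) s = F s
  rw [bdryOrbitExtendFun_eq ι L ρ x₀ _ hγ, bdryOrbitRestrictLinear_apply_coe, ← Module.End.mul_apply,
    ← map_mul, mul_inv_cancel, map_one, Module.End.one_apply, map_inv, inv_inv, inv_inv,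
    smul_inv_smul, hγ, vertex_apply_zero_eq]

/-- **`Fun(N(P)₀ × 𝒢/L, V) ≅ Coind_{Γ_{x₀}}^Γ Fun(𝒢/L, V)`** as `Γ`-representations, for a
transitive action on `P`. [cite: Brown1982CohomologyGroups, III §5] [cite: Schwermer2010, §6 (6.2)] -/
def bdryOrbitIso (htrans : ∀ x : P, ∃ γ : Γ, γ • x₀ = x) :
    bdryRep ι L ρ P hP 0 ≅ Rep.coind (vertexStabilizer (Γ := Γ) x₀).subtype (stratumRep ι L ρ x₀) where
  hom := bdryOrbitRestrict ι L ρ hP x₀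
  inv := bdryOrbitExtend ι L ρ P hP x₀
  hom_inv_id := bdryOrbitRestrict_comp_bdryOrbitExtend ι L ρ P hP x₀ htrans
  inv_hom_id := bdryOrbitExtend_comp_bdryOrbitRestrict ι L ρ P hP x₀

/-! ### Hecke operators -/

/-- **Restriction to the orbit commutes with the Hecke operators**: `[L g L]` on the boundary
cochains (`bdryHeckeRepHom`) corresponds to `Coind([L g L])` for the double-coset operator of the
stratum representation (`heckeRepHom` of the subgroup `Γ_{x₀}`) — both act on the coset variable
only. [cite: Schwermer2010, §6] -/
theorem bdryOrbitRestrict_comp_coindMap_heckeRepHom (g : 𝒢) :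
    bdryOrbitRestrict ι L ρ hP x₀ ≫
        Rep.coindMap (vertexStabilizer (Γ := Γ) x₀).subtype
          (heckeRepHom (ι.comp (vertexStabilizer (Γ := Γ) x₀).subtype) L
            (ρ.comp (vertexStabilizer (Γ := Γ) x₀).subtype) g) =
      bdryHeckeRepHom ι L ρ P hP g 0 ≫ bdryOrbitRestrict ι L ρ hP x₀ := by
  refine Rep.hom_ext (Representation.IntertwiningMap.ext (LinearMap.ext fun F => ?_))
  refine Subtype.ext (funext fun γ => ?_)
  change ArithmeticQuotient.heckeFun k L g V
      (fun c => ρ γ (F (vertex (γ⁻¹ • x₀), (ι γ)⁻¹ • c))) =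
    fun c => ρ γ (bdryHeckeFun k L P g 0 F (vertex (γ⁻¹ • x₀), (ι γ)⁻¹ • c))
  have key := heckeFun_coeffRepresentation ι L ρ g γ (fun c => F (vertex (γ⁻¹ • x₀), c))
  have h1 : (fun c => ρ γ (F (vertex (γ⁻¹ • x₀), (ι γ)⁻¹ • c))) =
      coeffRepresentation ι L ρ γ (fun c => F (vertex (γ⁻¹ • x₀), c)) :=
    funext fun c => by rw [coeffRepresentation_apply]
  rw [h1, key]
  funext c
  rw [coeffRepresentation_apply, bdryHeckeFun_apply]

/-! ### Cohomology: `H^q(Γ, Fun(N(P)₀ × 𝒢/L, V)) ≅ H^q(Γ_{x₀}, Fun(𝒢/L, V))` -/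

/-- `H^q` of the restriction to the orbit of `x₀`:
`H^q(Γ, Fun(N(P)₀ × 𝒢/L, V)) → H^q(Γ, Coind_{Γ_{x₀}}^Γ Fun(𝒢/L, V))`. [folklore] -/
abbrev bdryOrbitRestrictMap (q : ℕ) :
    groupCohomology (bdryRep ι L ρ P hP 0) q ⟶
      groupCohomology (Rep.coind (vertexStabilizer (Γ := Γ) x₀).subtype (stratumRep ι L ρ x₀)) q :=
  groupCohomology.map (MonoidHom.id Γ) (bdryOrbitRestrict ι L ρ hP x₀) q

/-- The Hecke operator `H^q(Coind T_g)` on `H^q(Γ, Coind_{Γ_{x₀}}^Γ Fun(𝒢/L, V))`. [folklore] -/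
abbrev coindHeckeOperator (g : 𝒢) (q : ℕ) :
    groupCohomology (Rep.coind (vertexStabilizer (Γ := Γ) x₀).subtype (stratumRep ι L ρ x₀)) q ⟶
      groupCohomology (Rep.coind (vertexStabilizer (Γ := Γ) x₀).subtype (stratumRep ι L ρ x₀)) q :=
  groupCohomology.map (MonoidHom.id Γ)
    (Rep.coindMap (vertexStabilizer (Γ := Γ) x₀).subtype
      (heckeRepHom (ι.comp (vertexStabilizer (Γ := Γ) x₀).subtype) L
        (ρ.comp (vertexStabilizer (Γ := Γ) x₀).subtype) g)) q

/-- The Hecke operator `T_g` on `H^q(Γ, Fun(N(P)₀ × 𝒢/L, V))` (column `0` of the boundary; the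
`bdryHeckeOperator` of `BoundaryRestrictionHecke`). [cite: Schwermer2010, §6] -/
abbrev bdryColumnHeckeOperator (g : 𝒢) (q : ℕ) :
    groupCohomology (bdryRep ι L ρ P hP 0) q ⟶ groupCohomology (bdryRep ι L ρ P hP 0) q :=
  groupCohomology.map (MonoidHom.id Γ) (bdryHeckeRepHom ι L ρ P hP g 0) q

/-- **Restriction to the orbit of `x₀` followed by Shapiro's isomorphism**:
`H^q(Γ, Fun(N(P)₀ × 𝒢/L, V)) → H^q(Γ, Coind Fun(𝒢/L, V)) ≅ H^q(Γ_{x₀}, Fun(𝒢/L, V))`, the map from the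
cohomology of (column `0` of) the boundary to the cohomology
`cohomology (ι.comp Γ_{x₀}.subtype) L (ρ.comp Γ_{x₀}.subtype) q` of the stratum of `x₀`
(Mathlib `groupCohomology.coindIso`). [cite: Harder1987, §1] [cite: Schwermer2010, §6 (6.2)] -/
def toStratumCohomology (q : ℕ) :
    groupCohomology (bdryRep ι L ρ P hP 0) q ⟶
      cohomology (ι.comp (vertexStabilizer (Γ := Γ) x₀).subtype) L
        (ρ.comp (vertexStabilizer (Γ := Γ) x₀).subtype) q :=
  bdryOrbitRestrictMap ι L ρ P hP x₀ q ≫ (groupCohomology.coindIso (stratumRep ι L ρ x₀) q).hom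

/-- `H^q` of the extension by zero:
`H^q(Γ, Coind_{Γ_{x₀}}^Γ Fun(𝒢/L, V)) → H^q(Γ, Fun(N(P)₀ × 𝒢/L, V))`. [folklore] -/
abbrev bdryOrbitExtendMap (q : ℕ) :
    groupCohomology (Rep.coind (vertexStabilizer (Γ := Γ) x₀).subtype (stratumRep ι L ρ x₀)) q ⟶
      groupCohomology (bdryRep ι L ρ P hP 0) q :=
  groupCohomology.map (MonoidHom.id Γ) (bdryOrbitExtend ι L ρ P hP x₀) q

/-- **Shapiro's isomorphism followed by extension by zero**:
`H^q(Γ_{x₀}, Fun(𝒢/L, V)) ≅ H^q(Γ, Coind Fun(𝒢/L, V)) → H^q(Γ, Fun(N(P)₀ × 𝒢/L, V))`. [cite: Schwermer2010, §6 (6.2)] -/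
def ofStratumCohomology (q : ℕ) :
    cohomology (ι.comp (vertexStabilizer (Γ := Γ) x₀).subtype) L
        (ρ.comp (vertexStabilizer (Γ := Γ) x₀).subtype) q ⟶
      groupCohomology (bdryRep ι L ρ P hP 0) q :=
  (groupCohomology.coindIso (stratumRep ι L ρ x₀) q).inv ≫ bdryOrbitExtendMap ι L ρ P hP x₀ q

/-- `H^q(Γ_{x₀}, Fun(𝒢/L, V))` is a direct summand of `H^q(Γ, Fun(N(P)₀ × 𝒢/L, V))` (every cusp
orbit contributes a summand of the boundary cohomology). [cite: Schwermer2010, §6 (6.1)–(6.2)] -/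
@[reassoc]
theorem ofStratumCohomology_comp_toStratumCohomology (q : ℕ) :
    ofStratumCohomology ι L ρ P hP x₀ q ≫ toStratumCohomology ι L ρ P hP x₀ q = 𝟙 _ := by
  simp only [ofStratumCohomology, toStratumCohomology, bdryOrbitExtendMap, bdryOrbitRestrictMap,
    Category.assoc]
  rw [← groupCohomology.map_id_comp_assoc, bdryOrbitExtend_comp_bdryOrbitRestrict,
    groupCohomology.map_id, Category.id_comp, Iso.inv_hom_id]

/-- For a transitive action on `P`, also `to ≫ of = 𝟙`. [cite: Schwermer2010, §6 (6.2)] -/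
@[reassoc]
theorem toStratumCohomology_comp_ofStratumCohomology (htrans : ∀ x : P, ∃ γ : Γ, γ • x₀ = x)
    (q : ℕ) :
    toStratumCohomology ι L ρ P hP x₀ q ≫ ofStratumCohomology ι L ρ P hP x₀ q = 𝟙 _ := by
  simp only [ofStratumCohomology, toStratumCohomology, bdryOrbitExtendMap, bdryOrbitRestrictMap,
    Category.assoc, Iso.hom_inv_id_assoc]
  rw [← groupCohomology.map_id_comp, bdryOrbitRestrict_comp_bdryOrbitExtend ι L ρ P hP x₀ htrans,
    groupCohomology.map_id]

/-- **`H^q(∂S_L, Ṽ) ≅ H^q(Γ_{x₀}, Fun(𝒢/L, V))` for a discrete building with one cusp orbit**: for a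
transitive action on `P`, `toStratumCohomology` is an isomorphism from the cohomology of column `0`
of the boundary double complex (= `H^q(∂S_L, Ṽ)` when `P` is an antichain) to the cohomology of the
stratum of `x₀` — for `GL₂`: `H^q(∂X̄_U, Ṽ) ≅ H^q(B(F), Fun(GL₂(𝔸_F^∞)/U, V))`.
[cite: Harder1987, §1] [cite: Schwermer2010, §6 (6.2)] -/
theorem isIso_toStratumCohomology (htrans : ∀ x : P, ∃ γ : Γ, γ • x₀ = x) (q : ℕ) :
    IsIso (toStratumCohomology ι L ρ P hP x₀ q) :=
  ⟨ofStratumCohomology ι L ρ P hP x₀ q,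
    toStratumCohomology_comp_ofStratumCohomology ι L ρ P hP x₀ htrans q,
    ofStratumCohomology_comp_toStratumCohomology ι L ρ P hP x₀ q⟩

/-- **Hecke-equivariance of the restriction to the orbit on `H^q`**:
`H^q(restrict) ∘ T_g = H^q(Coind T_g) ∘ H^q(restrict)`. [cite: Schwermer2010, §6] -/
@[reassoc]
theorem bdryOrbitRestrictMap_comp_coindHeckeOperator (g : 𝒢) (q : ℕ) :
    bdryOrbitRestrictMap ι L ρ P hP x₀ q ≫ coindHeckeOperator ι L ρ P x₀ g q =
      bdryColumnHeckeOperator ι L ρ P hP g q ≫ bdryOrbitRestrictMap ι L ρ P hP x₀ q := by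
  rw [bdryOrbitRestrictMap, coindHeckeOperator, bdryColumnHeckeOperator,
    ← groupCohomology.map_id_comp, bdryOrbitRestrict_comp_coindMap_heckeRepHom,
    groupCohomology.map_id_comp]

end TwistedQuotient

end Literature.NumberTheory.Automorphic
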